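import Mathlib
import Summits.ValiantsHypothesis.ValiantsHypothesis.Theorems.BarrierLeverPartitionMinorsHitByVPSimplexJoinTwoDeepRank
import Summits.ValiantsHypothesis.ValiantsHypothesis.Theorems.BarrierLeverPartitionMinorsHitByVPHiddenStatesUniversalConstraints

/-!
# Route BarrierLever — item `PartitionMinorsHitByVP` (stmt-ValiantsHypothesis-19717):
# THE WIDEST SQUARE IS NOT UNIFORM (`h ≥ 1000`) — a kernel instance of the (T)-gap above the simplex reach

Helper file (`--supports stmt-ValiantsHypothesis-19717`; cell valiant-natproofs, rung V4, 𝒟-side door (c), line `hidden_states`,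
uniform-menu lane; prover seat val-np-p3 gen 12). One bookkeeping `def` (`gridDesign`, the single-piece design `V_{N+1} × V_{N+1}`).
Closes NO item.

THE POINT (memo val-np-p3 g12 §2). The exact-support door allows factor slots with `N = (2h)²` options. The square of the widest
factor, `V_{N+1} × V_{N+1}` (one piece, two slots, every option live), is the natural first non-simplex piece of a base-`(2h)²` digit
menu. It is NOT uniform once `h ≥ 1000`: both slots are deep at level `2` (`1 + h + C(h,2) ≤ N`, `x := N + 1 − (1 + h + C(h,2)) ≥ 3h²`
independent level-2 relations each), so by the rank form of the two-deep-slots obstruction (`…TwoDeepRank`, p629548) every row family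
with more than `(N+1)² − x²` members of size `≤ 5` defeats it for EVERY table; and `(N+1)² − x² < C(h,5) ≤ #{U : |U| ≤ 5}` from
`h ≥ 1000` on (`(h−4)⁵ ≤ 120·C(h,5)`), so the small-sets-first row family (`UniversalConstraints.rowsSmallFirst`) is such a family
(**`widestSquare_not_uniform`**). Numerically the defect starts at `h ≈ 500`; the pure regime A (`…TwoDeep`) needs `h ≥ 1919`.
This is the `k = 2` instance of «the widest powers leave the uniform menu one by one» and the first brick of the window
`((2h)²((2h)²+1), ≈ 6.5·C(h,≤5))` in which no simplex-product piece is uniform (memo §2; numerics h = 2000, 4000, 8000).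

WHAT THIS IS NOT: a statement about ONE piece shape; `Stmt.uniformMenuSimplex` is refuted only numerically (other shapes need the
case map of memo §2(f)); nothing on `Stmt.simplexUniversal`, on crux 14610 or on VP ≠ VNP; item 19717 stays OPEN.
-/

set_option linter.dupNamespace false

namespace Summit.ValiantsHypothesis.ValiantsHypothesis.Theorems.BarrierLever.SimplexJoin

open Finset Matrix
open Summit.ValiantsHypothesis.ValiantsHypothesis.Theorems.BarrierLever.HiddenStates.UniversalConstraints
  (rowsSmallFirst rowsSmallFirst_injective card_small_rowsSmallFirst)

noncomputable section

/-- The single-piece design `V_{N+1} × V_{N+1}`: one piece, two slots, all `N` options of both slots live; column `k` is read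
as a pair of elements of `Fin (N+1) ≃ Option (Fin N)`. -/
def gridDesign (N : ℕ) (k : Fin ((N + 1) * (N + 1))) : Fin 1 × (Fin 2 → Option (Fin N)) :=
  (0, ![finSuccEquiv N (finProdFinEquiv.symm k).1, finSuccEquiv N (finProdFinEquiv.symm k).2])

/-- `gridDesign` is injective. -/
theorem gridDesign_injective (N : ℕ) : Function.Injective (gridDesign N) := by
  intro k k' hkk'
  have h2 := congrArg Prod.snd hkk'
  simp only [gridDesign] at h2
  have ha : (finProdFinEquiv.symm k).1 = (finProdFinEquiv.symm k').1 :=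
    (finSuccEquiv N).injective (by simpa using congrFun h2 0)
  have hb : (finProdFinEquiv.symm k).2 = (finProdFinEquiv.symm k').2 :=
    (finSuccEquiv N).injective (by simpa using congrFun h2 1)
  exact finProdFinEquiv.symm.injective (Prod.ext ha hb)

/-- Exact range: every pattern is a column (all options are live). -/
theorem gridDesign_live (N : ℕ) (c : Fin 1 × (Fin 2 → Option (Fin N))) :
    c ∈ Set.range (gridDesign N) ↔
      ∀ (f : Fin 2) (j : Fin N), c.2 f = some j → j ∈ (fun (_ : Fin 1) (_ : Fin 2) => (Finset.univ : Finset (Fin N))) c.1 f := by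
  constructor
  · intro _ f j _; exact Finset.mem_univ _
  · intro _
    refine ⟨finProdFinEquiv ((finSuccEquiv N).symm (c.2 0), (finSuccEquiv N).symm (c.2 1)), ?_⟩
    obtain ⟨c1, c2⟩ := c
    refine Prod.ext (Subsingleton.elim _ _) ?_
    funext f
    simp only [gridDesign, Equiv.symm_apply_apply, Equiv.apply_symm_apply]
    fin_cases f <;> rfl

/-- Arithmetic: `25 h⁴ ≤ 2^h` for `h ≥ 32`. -/
theorem quartic_le_two_pow (h : ℕ) (hh : 32 ≤ h) : 25 * h ^ 4 ≤ 2 ^ h := by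
  induction h, hh using Nat.le_induction with
  | base => norm_num
  | succ n hn ih =>
    have h4 : (n + 1) ^ 4 ≤ 2 * n ^ 4 := by
      have : 32 * n ^ 3 ≤ n ^ 4 := by
        calc 32 * n ^ 3 ≤ n * n ^ 3 := Nat.mul_le_mul_right _ hn
          _ = n ^ 4 := by ring
      nlinarith [this, Nat.zero_le n]
    calc 25 * (n + 1) ^ 4 ≤ 25 * (2 * n ^ 4) := Nat.mul_le_mul_left _ h4
      _ = 2 * (25 * n ^ 4) := by ring
      _ ≤ 2 * 2 ^ n := Nat.mul_le_mul_left _ ih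
      _ = 2 ^ (n + 1) := by ring

/-- Arithmetic: `((2h)²+1)² ≤ 2^h` for `h ≥ 32`. -/
theorem widestSquare_le_two_pow (h : ℕ) (hh : 32 ≤ h) : ((h + h) ^ 2 + 1) * ((h + h) ^ 2 + 1) ≤ 2 ^ h := by
  have h1 : ((h + h) ^ 2 + 1) * ((h + h) ^ 2 + 1) ≤ 25 * h ^ 4 := by
    have : 1 ≤ h ^ 2 := Nat.one_le_pow _ _ (by omega)
    nlinarith [this]
  exact h1.trans (quartic_le_two_pow h hh)

/-- Arithmetic heart: for `h ≥ 1000`, `((2h)²+1)² < C(h,5) + x²` with `x = (2h)² + 1 − (1 + h + C(h,2))`. -/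
theorem widestSquare_count (h : ℕ) (hh : 1000 ≤ h) :
    ((h + h) ^ 2 + 1) * ((h + h) ^ 2 + 1) <
      h.choose 5 + ((h + h) ^ 2 + 1 - ∑ i ∈ Finset.range (2 + 1), h.choose i) *
        ((h + h) ^ 2 + 1 - ∑ i ∈ Finset.range (2 + 1), h.choose i) := by
  -- the level-2 count `1 + h + C(h,2) ≤ h²`, so `x ≥ 3h² + 1`
  have hsum : ∑ i ∈ Finset.range (2 + 1), h.choose i = 1 + h + h.choose 2 := by
    simp [Finset.sum_range_succ, Nat.choose_zero_right, Nat.choose_one_right]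
  have hc2 : 1 + h + h.choose 2 ≤ h * h := by
    have h2t : 2 * h.choose 2 = h * h - h := by
      rw [Nat.choose_two_right, Nat.two_mul_div_two_of_even (Nat.even_mul_pred_self h), Nat.mul_sub_one]
    have hhh : 2 * h ≤ h * h := Nat.mul_le_mul_right h (by omega)
    omega
  have hx : 3 * (h * h) + 1 ≤ (h + h) ^ 2 + 1 - ∑ i ∈ Finset.range (2 + 1), h.choose i := by
    rw [hsum]
    have : (h + h) ^ 2 = 4 * (h * h) := by ring
    omega
  -- `(h−4)^5 ≤ 120·C(h,5)`
  have hc5 : (h - 4) ^ 5 ≤ 120 * h.choose 5 := by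
    have h1 := Nat.pow_sub_le_descFactorial h 5
    rw [Nat.descFactorial_eq_factorial_mul_choose] at h1
    have : (5 : ℕ).factorial = 120 := by decide
    rw [this] at h1
    have h2 : h + 1 - 5 = h - 4 := by omega
    rw [h2] at h1
    exact h1
  -- polynomial inequality in `k = h − 4 ≥ 996`
  obtain ⟨k, rfl⟩ : ∃ k, h = k + 4 := ⟨h - 4, by omega⟩
  have hk : 996 ≤ k := by omega
  rw [show k + 4 - 4 = k by omega] at hc5
  have hk2 : 996 * k ≤ k ^ 2 := by nlinarith
  have hk3 : 996 * k ^ 2 ≤ k ^ 3 := by nlinarith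
  have hk4 : 996 * k ^ 3 ≤ k ^ 4 := by nlinarith
  have hk5 : 996 * k ^ 4 ≤ k ^ 5 := by nlinarith
  set x := (k + 4 + (k + 4)) ^ 2 + 1 - ∑ i ∈ Finset.range (2 + 1), (k + 4).choose i with hxdef
  set K := (k + 4) ^ 4 with hK
  set Q := (k + 4) ^ 2 with hQ
  have hx' : 3 * Q + 1 ≤ x := by rw [hQ]; nlinarith [hx]
  have hx2 : 9 * K + 6 * Q + 1 ≤ x * x := by
    have := Nat.mul_le_mul hx' hx'
    have hKQ : K = Q * Q := by rw [hK, hQ]; ring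
    nlinarith [this, hKQ]
  have hlhs : ((k + 4 + (k + 4)) ^ 2 + 1) * ((k + 4 + (k + 4)) ^ 2 + 1) = 16 * K + 8 * Q + 1 := by
    rw [hK, hQ]; ring
  have hpoly : 840 * K + 240 * Q < 996 * k ^ 4 := by
    have hexp : 840 * K + 240 * Q = 840 * k ^ 4 + 13440 * k ^ 3 + 80880 * k ^ 2 + 216960 * k + 218880 := by
      rw [hK, hQ]; ring
    rw [hexp]
    nlinarith [hk, hk2, hk3, hk4]
  rw [hlhs]
  have : 7 * K + 2 * Q < (k + 4).choose 5 := by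
    have h120 : 120 * (7 * K + 2 * Q) < 120 * (k + 4).choose 5 := by
      calc 120 * (7 * K + 2 * Q) = 840 * K + 240 * Q := by ring
        _ < 996 * k ^ 4 := hpoly
        _ ≤ k ^ 5 := hk5
        _ ≤ 120 * (k + 4).choose 5 := hc5
    exact Nat.lt_of_mul_lt_mul_left h120
  omega

/-- **THE WIDEST SQUARE IS NOT UNIFORM (`h ≥ 1000`).** For the single-piece design `V_{(2h)²+1} × V_{(2h)²+1}` of the exact-support
door there is an injective row family `v` of its size (the small sets first) on which EVERY table gives a singular matrix. -/
theorem widestSquare_not_uniform (h : ℕ) (hh : 1000 ≤ h) :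
    ∃ v : Fin (((h + h) ^ 2 + 1) * ((h + h) ^ 2 + 1)) → Finset (Fin h), Function.Injective v ∧
      ∀ T : Fin 1 → Option (Fin 2 × Fin ((h + h) ^ 2)) → Fin h → ℂ,
        (Matrix.of fun i k : Fin (((h + h) ^ 2 + 1) * ((h + h) ^ 2 + 1)) => ∏ a ∈ v i,
          (T (gridDesign ((h + h) ^ 2) k).1 none a +
            ∑ f : Fin 2, ((gridDesign ((h + h) ^ 2) k).2 f).elim 0 fun j =>
              T (gridDesign ((h + h) ^ 2) k).1 (some (f, j)) a)).det = 0 := by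
  classical
  set N := (h + h) ^ 2 with hN
  set r := (N + 1) * (N + 1) with hr
  have hr2 : r ≤ 2 ^ h := widestSquare_le_two_pow h (by omega)
  refine ⟨rowsSmallFirst h 6 r hr2, rowsSmallFirst_injective h 6 r hr2, fun T => ?_⟩
  refine det_eq_zero_of_two_deep_slots_rank h 2 1 2 N r Finset.univ (rowsSmallFirst h 6 r hr2)
    (fun _ _ => Finset.univ) (gridDesign N) (gridDesign_injective N) (gridDesign_live N) 0 0 1 (by decide) ?_ T
  -- the count
  have hA : (Finset.univ : Finset (Fin h)).card = h := Finset.card_fin h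
  rw [hA, Finset.card_univ, Fintype.card_fin]
  have hsmall : min r (∑ i ∈ Finset.range 6, h.choose i) ≤
      (Finset.univ.filter fun i : Fin r =>
        rowsSmallFirst h 6 r hr2 i ⊆ Finset.univ ∧ (rowsSmallFirst h 6 r hr2 i).card ≤ 2 * 2 + 1).card := by
    refine (card_small_rowsSmallFirst h 6 r hr2).trans (Finset.card_le_card ?_)
    intro i
    simp only [Finset.mem_filter, Finset.mem_univ, true_and, Finset.subset_univ]
    omega
  have h5 : h.choose 5 ≤ ∑ i ∈ Finset.range 6, h.choose i :=
    Finset.single_le_sum (f := fun i => h.choose i) (fun _ _ => Nat.zero_le _) (by simp)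
  have hcount := widestSquare_count h hh
  rcases le_total r (∑ i ∈ Finset.range 6, h.choose i) with hle | hle
  · rw [min_eq_left hle] at hsmall
    have hxpos : 0 < (N + 1 - ∑ i ∈ Finset.range (2 + 1), h.choose i) := by
      have := level_two_le_widest h (by omega)
      rw [hN]; omega
    nlinarith [hsmall, hxpos]
  · rw [min_eq_right hle] at hsmall
    have : r < (∑ i ∈ Finset.range 6, h.choose i) +
        (N + 1 - ∑ i ∈ Finset.range (2 + 1), h.choose i) * (N + 1 - ∑ i ∈ Finset.range (2 + 1), h.choose i) := by
      have := hcount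
      rw [← hN] at this
      omega
    omega

end

end Summit.ValiantsHypothesis.ValiantsHypothesis.Theorems.BarrierLever.SimplexJoin
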